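import Summits.BirchSwinnertonDyer.BirchSwinnertonDyer.Theses.PrintX6
import Summits.BirchSwinnertonDyer.BirchSwinnertonDyer.Theorems.PrintX6KobayashiUpperHalf
import Summits.BirchSwinnertonDyer.BirchSwinnertonDyer.Theorems.SignedLowerHalvesKobayashiLowerHalfSemistableScopeS
import Summits.BirchSwinnertonDyer.Rank1Residual.Supersingular.X6RankZeroLeafTarget
import Literature.NumberTheory.EllipticCurves.ModularParametrizationBCDTProofs
import Literature.NumberTheory.EllipticCurves.BurungaleSkinnerTianWan2024.SupersingularPPartOPEN
import Literature.NumberTheory.EllipticCurves.Wuthrich2014.ThreeAdicImageSupersingularProofs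
import HarnessLib

/-!
# Route `PrintX6` — the two Eisenstein cruxes and the leaf BY NAME from Burungale–Skinner–Tian–Wan 2024,
# tier by tier, with the exact published-input ledger of each road (cell `bsd-print-x6`, seat p1 gen 1;
# lane «BSTW 2024 arXiv:2409.01350 Thm 1.3/1.5 r0 p-part BY NAME»; a `--supports` file: closes nothing)

HONEST FRAMING. Every theorem below is CONDITIONAL on an explicitly labelled OPEN binder transcribing the
PREPRINT Burungale–Skinner–Tian–Wan, *Zeta elements for elliptic curves and applications*, arXiv:2409.01350v2
(`…_OPEN : Prop`, `[claim: …, status: under-review]`, NEVER a theorem) — taken as a hypothesis, never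
discharged — plus the tree's PUBLISHED named facts BY NAME. Nothing is asserted about any curve; no `def`, no
named fact, no restatement (R-0.2): every proof is a composition of landed consumers. PARTITION currency
(D-0054 / R-0.1): 0 cells move; the cruxes `EisensteinHalfFiveLe` (stmt-BirchSwinnertonDyer-20276) and
`EisensteinHalfAtThree` (stmt-BirchSwinnertonDyer-20285) stay OPEN (declared residuals of the route).
BEYOND-PRINT THEOREM: **NO** (the whole lane is inside the preprint's printed scope).

## What this file pins down: the exact print-dependence of the leaf `ClassX6 ∧ r_an = 0`, road by road

With `Assembly` (p535696 `printX6_assembly_proof`) and `UpperHalfX6` (p535414 `upperHalfX6_proof`) PROVED, the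
leaf `WAllCornerX6r0` over the nine refereed inputs `PublishedInputsX6` is EXACTLY the two Eisenstein cruxes. This
file writes each crux, and then the leaf, as a theorem of the shape «OPEN binder → published facts → crux», for
each of the three BSTW binders the tree carries (and, road K, for the sister route's crux itself), so that the residual of the by-name road is ONE named `Prop` per
road and the published ledger of each road is explicit in a kernel-checked signature. It imports the route file
DIRECTLY (no Theorems-on-Theorems stacking in the route's cone): the cruxes are reached through the ty2 interface's
route-independent adapters `X6RankZero.eisensteinHalf{FiveLe,AtThree}_of_forall_kobayashiLowerDivisibility` (item
bodies verbatim) and the leaf through the assembly kernel form `X6RankZero.wallCornerX6r0_of_upper_of_eisensteinHalves`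
(= item `Assembly`), with the item `UpperHalfX6` either taken BY NAME (`…_of_printX6_…`, the PLAN's turnkey shape) or
discharged in the kernel by seat p2's route-independent chain `X6.missingUpperBoundAt_rankZero_of_thm41`
(`…_of_publishedInputsX6_…`):

| road | OPEN binder (PRE) | published facts consumed BY NAME | theorems |
|---|---|---|---|
| S (cell-verified regime, p ≥ 5; p = 3 twin) | `Supersingular.BurungaleSkinnerTianWan2024_thm13_scopedS_OPEN` / `…_scopedAtThreeS_OPEN` | `PublishedInputsX6` (cruxes: Kobayashi 1.2, Kim 3.15, modularity ×2, GZK; leaf: all nine) + Diamond 1995 / Ribet 1990 `diamond1995_refinedSerre` (for the class-wide (ram) prime + auxiliary field `BSTWScope_hasAuxWitness_of_goodSS`) | `signedLowerDivisibilityFiveLe_of_thm13_scopedS_OPEN` (birth stub 1 VERBATIM), `eisensteinHalfFiveLe_of_thm13_scopedS_OPEN`, `eisensteinHalfAtThree_of_thm13_scopedAtThreeS_OPEN`, `wallCornerX6r0_of_printX6_tiersS_S3` (turnkey shape), `wallCornerX6r0_of_publishedInputsX6_tiersS_S3`, `wallCornerX6r0_of_facts_tiersS_S3` (the eight input items unfolded)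 |
| P (Thm. 1.3 as printed) | `Supersingular.BurungaleSkinnerTianWan2024_thm13_OPEN` | `PublishedInputsX6` only (NO level-lowering: the printed statement has no scope hypothesis) | `signedLowerDivisibilityFiveLe_of_thm13_OPEN` (birth stub 1 VERBATIM from the binder ALONE), `eisensteinHalfFiveLe_of_thm13_OPEN`, `eisensteinHalfAtThree_of_thm13_OPEN`, `wallCornerX6r0_of_printX6_thm13_OPEN`, `wallCornerX6r0_of_publishedInputsX6_thm13_OPEN` |
| V (Thm. 1.5, the value statement) | `BurungaleSkinnerTianWan2024.thm15_pPart_OPEN` | GZK only | `eisensteinHalfFiveLe_of_thm15_OPEN`, `eisensteinHalfAtThree_of_thm15_OPEN`, `eisensteinHalves_of_thm15_OPEN`, `wallCornerX6r0_of_printX6_thm15_OPEN` (sanity; the direct row is gen 0's `PrintX6.wallCornerX6r0_of_bstw15_OPEN`, p531830 — not restated) |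
| K (the sister route's crux, stmt-19000) | `Theses.SignedLowerHalves.KobayashiLowerHalfSemistable` (OPEN item of route `SignedLowerHalves`, cell bsd-ssimc) | `PublishedInputsX6` (as road P) | `stub_signedLowerDivisibility{FiveLe,AtThree}_of_kobayashiLowerHalfSemistable` (both birth stubs 1 are RESTRICTIONS of 19000), `eisensteinHalves_of_kobayashiLowerHalfSemistable` (PLAN v2 p1 (a)), `wallCornerX6r0_of_printX6_kobayashiLowerHalfSemistable` (the header's «mooted-if» clause) |

Road S is the regime the sister cell bsd-ssimc verified line by line (REPORT-bstw-6 and -9; litref round C4-R3 (ζ)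
PASS-in-cell with the cell repairs at `p ≥ 5`; GAP(line) at `p = 3` ⇐ [SV-S-Ohta], flag `BSTW13-p3-OhtaES-preprint`);
road P is never stronger than print; road V is the minimal binder set. The `hW`-FREE closers differ from the tree's
`WAll.wallCornerX6r0_of_bstw13TiersS_S3` / `AltClosersPre.wallCornerX6r0_of_BSTW13_tiers` /
`X6.bsdp_of_BSTW13_OPEN_of_analyticRank_eq_zero` exactly in the UPPER half: Wuthrich 2014 Prop. 21 (`sha_dvd_analyticSha`,
referee question R-WU14-P21-SS) is replaced by the route's item `UpperHalfX6` (Kobayashi Thm. 4.1 (b) + Thm. 1.2 + Kim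
Cor. 3.15 + period units; kernel chain p532875, item closed p535414).

## Hypothesis discharge on the leaf (printed hypothesis → tree theorem; no certificate needed on A6)

BSTW Thm. 1.3 / 1.5 print: "`E/ℚ` semistable" = `ClassX6.semistable`; "`p > 2` supersingular" = the leaf binder
`p ≠ 2` (here `5 ≤ p` / `p = 3`) + `ClassX6.goodSS`; "(1.7) `a_p = 0` if `p = 3`" = `BurungaleSkinnerTianWan2024.h4_of_classX6`;
"`ord_{s=1} L = r ≤ 1`" = the leaf binder `r_an = 0`. The S-scope datum ((ram) prime `q ∥ N` with `p ∤ ord_q Δ` and the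
auxiliary imaginary quadratic field of II §2.3) = `BSTWScope_hasAuxWitness_of_goodSS` (modularity + Diamond/Ribet) —
`hasAuxWitness_of_leaf` below. Image / (irr) / `p ∤ #E(ℚ)_tors` enter only the DESCENT from `KobayashiLowerDivisibility`
to the valuation inequality and are tree theorems on the class (`ClassX6.irr`, `ClassX6.frobeniusTrace_eq_zero`; ty2
interface p532431). So the per-class certificate of the lane's sentence («image, (irr), p ∤ N·Tam») is EMPTY on A6:
every printed hypothesis is decided by `ClassX6 W p ∧ p ≠ 2 ∧ r_an = 0`.

References: [BurungaleSkinnerTianWan2024] Thm. 1.3 (p. 3), Thm. 1.5 (p. 4), (1.7) (p. 6), II §2.3 (PRE);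
[Kobayashi2003] Thm. 1.2, Conjecture (p. 2); [BDKim2013] Cor. 3.15 (p. 199); [Pollack2003] Thm. 5.6;
[Ribet1990] Thm. 1.1; [Diamond1995RefinedSerre] Thm. 1.1; [BCDTJAMS2001] Thm. A; [Miller2011LMS] Def. 1.1;
HOME/PLAN.md v1 p1 (ii)–(iii); HOME/REFEREE.md R-0, D-1.
-/

set_option autoImplicit false
set_option linter.dupNamespace false

noncomputable section

open scoped Classical

open WeierstrassCurve Literature.NumberTheory.EllipticCurves
  Literature.NumberTheory.EllipticCurves.ModularForms
  Literature.NumberTheory.EllipticCurves.Rank1Residual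
  Literature.NumberTheory.EllipticCurves.Rank1Residual.Typed
  Literature.NumberTheory.EllipticCurves.BurungaleSkinnerTianWan2024
  Summit.BirchSwinnertonDyer.Rank1Residual.Supersingular
  Summit.BirchSwinnertonDyer.BirchSwinnertonDyer.Theses.PrintX6

namespace Summit.BirchSwinnertonDyer.BirchSwinnertonDyer.Theorems.PrintX6

/-! ### §0 The published side: what the route's inputs give the BSTW roads -/

/-- Modularity "Version `L`" (`exists_isNewformOf`: a newform of level `N_E` with `L(E,s) = L(f,s)`) is a
CONSEQUENCE of conjunct 7 of `PublishedInputsX6` (BCDT 2001 Thm. A as parametrisation data), by the tree theorem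
`exists_isNewformOf_of_nonempty_modularParametrizationData`. It is the modularity spelling the S-scoped BSTW
consumers take. [cite: BCDTJAMS2001, Thm. A and p. 845 (6) ⇒ (2)] -/
theorem exists_isNewformOf_of_publishedInputsX6 (hPub : PublishedInputsX6) : exists_isNewformOf :=
  exists_isNewformOf_of_nonempty_modularParametrizationData hPub.2.2.2.2.2.2.1

/-- **The S-scope datum of BSTW II §2.3 exists at EVERY leaf pair** — a (ram) prime `q ∥ N` with `p ∤ ord_q(Δ)`
and an auxiliary imaginary quadratic field (`BSTWScope.HasAuxWitness W p`), from modularity (inside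
`PublishedInputsX6`) and Diamond 1995 / Ribet 1990 level-lowering (`hLL`) by the sister cell's theorem
`BSTWScope_hasAuxWitness_of_goodSS`: on A6 the scope hypothesis of the S-scoped tiers needs NO per-class
certificate. [cite: Ribet1990, Thm. 1.1] [cite: Diamond1995RefinedSerre, Thm. 1.1] -/
theorem hasAuxWitness_of_leaf (hPub : PublishedInputsX6)
    (hLL : Literature.NumberTheory.Automorphic.diamond1995_refinedSerre)
    (W : WeierstrassCurve ℚ) [W.IsElliptic] [W.IsGloballyMinimal] (p : ℕ) [Fact p.Prime]
    (hp : p ≠ 2) (hX : ClassX6 W p) : BSTWScope.HasAuxWitness W p :=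
  BSTWScope_hasAuxWitness_of_goodSS (exists_isNewformOf_of_publishedInputsX6 hPub) hLL W p hp hX.2.1 hX.1

/-! ### §1 Road S — the S-scoped tiers (`p ≥ 5`: the cell-verified regime; `p = 3`: twin resting on (3-ii)♭) -/

/-- **Birth-skeleton stub 1 `stub_signedLowerDivisibilityFiveLe` (registered on stmt-…-20276, signature VERBATIM)
MODULO road S**: the `p ≥ 5` S-scoped tier (`h5t`) APPLIED AT THE LEAF — "`p ≥ 5`", "semistable" = `hX.2.1`,
"supersingular" = `hX.1`, scope datum = `hasAuxWitness_of_leaf` (modularity from the inputs + Diamond/Ribet `hLL`) —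
then the Eisenstein half of the main conjecture (`kobayashiLowerDivisibility_of_mainConjecture`) for the sign `+1`, at
every non-CM X6 ∧ r_an = 0 pair with `p ≥ 5` (`¬CM`, `r_an = 0` unused; = the sister cell's
`X6_kobayashiLowerDivisibility_of_thm13_scopedS_OPEN` in the stub's binder shape). CONDITIONAL (`conditional-result`);
the stub is not discharged. [claim: BurungaleSkinnerTianWan2024, status: under-review]
[cite: Kobayashi2003, Conjecture (Main Conjecture) (p. 2)] [cite: Ribet1990, Thm. 1.1] -/
theorem signedLowerDivisibilityFiveLe_of_thm13_scopedS_OPEN (hPub : PublishedInputsX6)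
    (hLL : Literature.NumberTheory.Automorphic.diamond1995_refinedSerre)
    (h5t : BurungaleSkinnerTianWan2024_thm13_scopedS_OPEN) :
    ∀ (W : WeierstrassCurve ℚ) [W.IsElliptic] [W.IsGloballyMinimal] (p : ℕ) [Fact p.Prime],
      ¬ W.HasCM → 5 ≤ p → Literature.NumberTheory.EllipticCurves.Rank1Residual.ClassX6 W p →
      W.analyticRank = 0 →
      ∃ ε : ℤˣ, Summit.BirchSwinnertonDyer.Rank1Residual.Supersingular.KobayashiLowerDivisibility W p ε := by
  intro W _ _ p _ _ h5 hX _
  exact ⟨1, kobayashiLowerDivisibility_of_mainConjecture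
    (h5t W p h5 hX.2.1 hX.1 (hasAuxWitness_of_leaf hPub hLL W p (by omega) hX) 1)⟩

/-- The `p = 3` twin of stub 1 MODULO road S at 3 (the `p = 3` S-scoped tier `h3t`, carrying the located residual
(3-ii)♭ ⇐ [SV-S-Ohta]; flag `BSTW13-p3-OhtaES-preprint`); "(1.7) `a_3 = 0`" = `h4_of_classX6` (inside `ClassX6` at 3).
CONDITIONAL; nothing discharged. [claim: BurungaleSkinnerTianWan2024, status: under-review]
[cite: Kobayashi2003, Conjecture (Main Conjecture) (p. 2)] [cite: Ribet1990, Thm. 1.1] -/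
theorem signedLowerDivisibilityAtThree_of_thm13_scopedAtThreeS_OPEN (hPub : PublishedInputsX6)
    (hLL : Literature.NumberTheory.Automorphic.diamond1995_refinedSerre)
    (h3t : BurungaleSkinnerTianWan2024_thm13_scopedAtThreeS_OPEN) :
    ∀ (W : WeierstrassCurve ℚ) [W.IsElliptic] [W.IsGloballyMinimal] (p : ℕ) [Fact p.Prime],
      ¬ W.HasCM → p = 3 → Literature.NumberTheory.EllipticCurves.Rank1Residual.ClassX6 W p →
      W.analyticRank = 0 →
      ∃ ε : ℤˣ, Summit.BirchSwinnertonDyer.Rank1Residual.Supersingular.KobayashiLowerDivisibility W p ε := by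
  intro W _ _ p _ _ h3 hX _
  exact ⟨1, kobayashiLowerDivisibility_of_mainConjecture
    (h3t W p h3 hX.2.1 hX.1 (h4_of_classX6 W p hX h3) (hasAuxWitness_of_leaf hPub hLL W p (by omega) hX) 1)⟩

/-- **Crux 2 `EisensteinHalfFiveLe` (stmt-BirchSwinnertonDyer-20276) BY NAME on road S**: `PublishedInputsX6 →
diamond1995_refinedSerre → thm13_scopedS_OPEN → EisensteinHalfFiveLe` — stub 1 above fed to the ty2 interface's
adapter `X6RankZero.eisensteinHalfFiveLe_of_forall_kobayashiLowerDivisibility` (the descent: Kobayashi Thm. 1.2, Kim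
Cor. 3.15, Pollack = tree theorem, modularity, GZK — conjuncts 1, 3, 7, 8, 9 of the inputs). The item's type VERBATIM
as conclusion. CONDITIONAL on ONE PRE binder (+ PUB facts); the crux stays OPEN; not bookable (R-0.1).
[claim: BurungaleSkinnerTianWan2024, status: under-review] [cite: Kobayashi2003, Thm. 1.2 and Conjecture (p. 2)]
[cite: BDKim2013, Cor. 3.15 (p. 199)] [cite: Ribet1990, Thm. 1.1] [cite: Miller2011LMS, Def. 1.1] -/
theorem eisensteinHalfFiveLe_of_thm13_scopedS_OPEN (hPub : PublishedInputsX6)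
    (hLL : Literature.NumberTheory.Automorphic.diamond1995_refinedSerre)
    (h5t : BurungaleSkinnerTianWan2024_thm13_scopedS_OPEN) : EisensteinHalfFiveLe := by
  have ⟨h12, _, hKim, _, _, _, hmodP, hmod, hGZK⟩ := hPub
  exact X6RankZero.eisensteinHalfFiveLe_of_forall_kobayashiLowerDivisibility h12 hKim hmodP hmod hGZK
    fun W _ _ p _ h5 hX h0 ↦
      signedLowerDivisibilityFiveLe_of_thm13_scopedS_OPEN hPub hLL h5t W p (ClassX6.not_hasCM W hX) h5 hX h0

/-- **Residual crux 3 `EisensteinHalfAtThree` (stmt-BirchSwinnertonDyer-20285) BY NAME on road S at 3**: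
`PublishedInputsX6 → diamond1995_refinedSerre → thm13_scopedAtThreeS_OPEN → EisensteinHalfAtThree`. CONDITIONAL on
the `p = 3` PRE tier (⊃ (3-ii)♭, unpublished); the crux stays OPEN, the declared residual of the route.
[claim: BurungaleSkinnerTianWan2024, status: under-review] [cite: Kobayashi2003, Thm. 1.2 and Conjecture (p. 2)]
[cite: BDKim2013, Cor. 3.15 (p. 199)] [cite: Ribet1990, Thm. 1.1] [cite: Miller2011LMS, Def. 1.1] -/
theorem eisensteinHalfAtThree_of_thm13_scopedAtThreeS_OPEN (hPub : PublishedInputsX6)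
    (hLL : Literature.NumberTheory.Automorphic.diamond1995_refinedSerre)
    (h3t : BurungaleSkinnerTianWan2024_thm13_scopedAtThreeS_OPEN) : EisensteinHalfAtThree := by
  have ⟨h12, _, hKim, _, _, _, hmodP, hmod, hGZK⟩ := hPub
  exact X6RankZero.eisensteinHalfAtThree_of_forall_kobayashiLowerDivisibility h12 hKim hmodP hmod hGZK
    fun W _ _ p _ h3 hX h0 ↦
      signedLowerDivisibilityAtThree_of_thm13_scopedAtThreeS_OPEN hPub hLL h3t W p (ClassX6.not_hasCM W hX)
        h3 hX h0

/-- **The leaf on road S in the PLAN's turnkey shape** (PLAN v1 p1 (iii)): `PublishedInputsX6 → UpperHalfX6 →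
diamond1995_refinedSerre → thm13_scopedS_OPEN → thm13_scopedAtThreeS_OPEN → WAllCornerX6r0` — the route items
`PublishedInputsX6`, `UpperHalfX6` BY NAME (the latter PROVED: `upperHalfX6_proof`, p535414), the two cruxes from road
S, glued by the ty2 assembly kernel form `X6RankZero.wallCornerX6r0_of_upper_of_eisensteinHalves` (= the route's
`Assembly`, p535696). Wuthrich-FREE: contrast `WAll.wallCornerX6r0_of_bstw13TiersS_S3`. Two PRE binders; CONDITIONAL;
0 cells booked. [claim: BurungaleSkinnerTianWan2024, status: under-review] [cite: Kobayashi2003, Thm. 1.2, Thm. 4.1]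
[cite: BDKim2013, Cor. 3.15 (p. 199)] [cite: Ribet1990, Thm. 1.1] [cite: Miller2011LMS, §1 and Def. 1.1] -/
theorem wallCornerX6r0_of_printX6_tiersS_S3 (hPub : PublishedInputsX6) (hU : UpperHalfX6)
    (hLL : Literature.NumberTheory.Automorphic.diamond1995_refinedSerre)
    (h5t : BurungaleSkinnerTianWan2024_thm13_scopedS_OPEN)
    (h3t : BurungaleSkinnerTianWan2024_thm13_scopedAtThreeS_OPEN) : Summit.BirchSwinnertonDyer.WAllCornerX6r0 :=
  X6RankZero.wallCornerX6r0_of_upper_of_eisensteinHalves hPub.2.2.2.2.2.2.2.2 (hU hPub)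
    (eisensteinHalfFiveLe_of_thm13_scopedS_OPEN hPub hLL h5t)
    (eisensteinHalfAtThree_of_thm13_scopedAtThreeS_OPEN hPub hLL h3t)

/-- **The leaf on road S from the inputs ALONE** (the upper half discharged in the kernel by seat p2's
route-independent chain `X6.missingUpperBoundAt_rankZero_of_thm41`: Kobayashi Thm. 4.1 (b) + Thm. 1.2 + Kim Cor. 3.15
+ period units, image by `ClassX6.imageContainsSL2` — no Wuthrich Prop. 21): `PublishedInputsX6 →
diamond1995_refinedSerre → thm13_scopedS_OPEN → thm13_scopedAtThreeS_OPEN → WAllCornerX6r0`. Two PRE binders + ten PUB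
facts (nine inputs + Diamond/Ribet); CONDITIONAL; 0 cells booked. [claim: BurungaleSkinnerTianWan2024, status: under-review]
[cite: Kobayashi2003, Thm. 1.2, Thm. 4.1 (p. 8)] [cite: BDKim2013, Cor. 3.15 (p. 199)] [cite: Ribet1990, Thm. 1.1]
[cite: Miller2011LMS, §1 and Def. 1.1] -/
theorem wallCornerX6r0_of_publishedInputsX6_tiersS_S3 (hPub : PublishedInputsX6)
    (hLL : Literature.NumberTheory.Automorphic.diamond1995_refinedSerre)
    (h5t : BurungaleSkinnerTianWan2024_thm13_scopedS_OPEN)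
    (h3t : BurungaleSkinnerTianWan2024_thm13_scopedAtThreeS_OPEN) : Summit.BirchSwinnertonDyer.WAllCornerX6r0 := by
  have ⟨h12, h41, hKim, hper, hper3, _, hmodP, hmod, hGZK⟩ := hPub
  exact wallCornerX6r0_of_printX6_tiersS_S3 hPub
    (fun _ W _ _ p _ hp hX h0 ↦
      X6.missingUpperBoundAt_rankZero_of_thm41 W p h41 h12 hKim hper hper3 hmodP hmod hGZK hp hX h0)
    hLL h5t h3t

/-- **Road S with the inputs BY PARTS — the complete by-name ledger of the print route in one signature**: the leaf
⟸ {two PRE tiers; Kobayashi Thm. 1.2 (item 19286), Thm. 4.1 (19287); Kim Cor. 3.15 (19288); period units at `p ≥ 5`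
(19290) and at `3` (19291); modularity ×2 (19266, 19273); GZK (19921); Diamond/Ribet}; conjunct 6 of the inputs,
Wuthrich 2014 Lemma 20, is the tree theorem `Wuthrich2014.lemma20_surjective_threeAdic_of_semistable_holds` (as in the
glue item 20376). CONDITIONAL; closes nothing. [claim: BurungaleSkinnerTianWan2024, status: under-review]
[cite: Kobayashi2003, Thm. 1.2, Thm. 4.1] [cite: BDKim2013, Cor. 3.15 (p. 199)] [cite: Wuthrich2014, Lemma 20 (p. 399)]
[cite: Miller2011LMS, §1 and Def. 1.1] -/
theorem wallCornerX6r0_of_facts_tiersS_S3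
    (h12 : Kobayashi2003.thm12_signedSelmerDual_finite_torsion)
    (h41 : Kobayashi2003.thm41_signedCharIdeal_divisibility)
    (hKim : BDKim2013.cor315_signedCharValue_rankZero)
    (hper : realPeriodRat_eq_unit_mul_plusPeriod) (hper3 : realPeriodRat_eq_unit_mul_plusPeriod_three)
    (hmodP : nonempty_modularParametrizationData) (hmod : WeierstrassCurve.hasEntireLFunction_rat)
    (hGZK : rank_eq_analyticRank_of_analyticRank_le_one)
    (hLL : Literature.NumberTheory.Automorphic.diamond1995_refinedSerre)
    (h5t : BurungaleSkinnerTianWan2024_thm13_scopedS_OPEN)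
    (h3t : BurungaleSkinnerTianWan2024_thm13_scopedAtThreeS_OPEN) : Summit.BirchSwinnertonDyer.WAllCornerX6r0 :=
  wallCornerX6r0_of_publishedInputsX6_tiersS_S3
    ⟨h12, h41, hKim, hper, hper3, Wuthrich2014.lemma20_surjective_threeAdic_of_semistable_holds, hmodP, hmod, hGZK⟩
    hLL h5t h3t

/-! ### §2 Road P — Thm. 1.3 AS PRINTED (no scope hypothesis, hence no level-lowering input) -/

/-- **Birth-skeleton stub 1 VERBATIM from the PRINTED binder ALONE** — no published input at all: Thm. 1.3 as
printed (`h13`) has no scope hypothesis, and its hypotheses on the leaf are `ClassX6.semistable`, `ClassX6.goodSS`,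
`h4_of_classX6` (ty2's `X6.kobayashiLowerDivisibility_of_thm13_OPEN`). The by-name residual of stub 1 is therefore
EXACTLY ONE `Prop`. CONDITIONAL (`conditional-result`). [claim: BurungaleSkinnerTianWan2024, status: under-review]
[cite: Kobayashi2003, Conjecture (Main Conjecture) (p. 2)] -/
theorem signedLowerDivisibilityFiveLe_of_thm13_OPEN (h13 : BurungaleSkinnerTianWan2024_thm13_OPEN) :
    ∀ (W : WeierstrassCurve ℚ) [W.IsElliptic] [W.IsGloballyMinimal] (p : ℕ) [Fact p.Prime],
      ¬ W.HasCM → 5 ≤ p → Literature.NumberTheory.EllipticCurves.Rank1Residual.ClassX6 W p →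
      W.analyticRank = 0 →
      ∃ ε : ℤˣ, Summit.BirchSwinnertonDyer.Rank1Residual.Supersingular.KobayashiLowerDivisibility W p ε := by
  intro W _ _ p _ _ h5 hX _
  exact ⟨1, X6.kobayashiLowerDivisibility_of_thm13_OPEN W p h13 (by omega) hX 1⟩

/-- **Crux 2 BY NAME on road P**: `PublishedInputsX6 → thm13_OPEN → EisensteinHalfFiveLe` (the inputs enter only the
descent: Kobayashi Thm. 1.2, Kim Cor. 3.15, modularity, GZK). CONDITIONAL; the crux stays OPEN.
[claim: BurungaleSkinnerTianWan2024, status: under-review] [cite: Kobayashi2003, Thm. 1.2 and Conjecture (p. 2)]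
[cite: BDKim2013, Cor. 3.15 (p. 199)] [cite: Miller2011LMS, Def. 1.1] -/
theorem eisensteinHalfFiveLe_of_thm13_OPEN (hPub : PublishedInputsX6)
    (h13 : BurungaleSkinnerTianWan2024_thm13_OPEN) : EisensteinHalfFiveLe := by
  have ⟨h12, _, hKim, _, _, _, hmodP, hmod, hGZK⟩ := hPub
  exact X6RankZero.eisensteinHalfFiveLe_of_forall_kobayashiLowerDivisibility h12 hKim hmodP hmod hGZK
    fun W _ _ p _ h5 hX h0 ↦
      signedLowerDivisibilityFiveLe_of_thm13_OPEN h13 W p (ClassX6.not_hasCM W hX) h5 hX h0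

/-- **Residual crux 3 BY NAME on road P**: `PublishedInputsX6 → thm13_OPEN → EisensteinHalfAtThree` (at `p = 3`
the printed side condition (1.7) `a_3 = 0` is inside `ClassX6 W 3`). CONDITIONAL; the crux stays OPEN.
[claim: BurungaleSkinnerTianWan2024, status: under-review] [cite: Kobayashi2003, Thm. 1.2 and Conjecture (p. 2)]
[cite: BDKim2013, Cor. 3.15 (p. 199)] [cite: Miller2011LMS, Def. 1.1] -/
theorem eisensteinHalfAtThree_of_thm13_OPEN (hPub : PublishedInputsX6)
    (h13 : BurungaleSkinnerTianWan2024_thm13_OPEN) : EisensteinHalfAtThree := by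
  have ⟨h12, _, hKim, _, _, _, hmodP, hmod, hGZK⟩ := hPub
  exact X6RankZero.eisensteinHalfAtThree_of_forall_kobayashiLowerDivisibility h12 hKim hmodP hmod hGZK
    fun W _ _ p _ h3 hX _ ↦ ⟨1, X6.kobayashiLowerDivisibility_of_thm13_OPEN W p h13 (by omega) hX 1⟩

/-- **The leaf on road P in the turnkey shape, Wuthrich-FREE and level-lowering-FREE**: `PublishedInputsX6 →
UpperHalfX6 → thm13_OPEN → WAllCornerX6r0` — ONE PRE binder (Thm. 1.3 as printed) + the route's items by name.
Compare the tree's `X6.bsdp_of_BSTW13_OPEN_of_analyticRank_eq_zero` (same binder, Wuthrich Prop. 21 for the upper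
half). CONDITIONAL; 0 cells booked. [claim: BurungaleSkinnerTianWan2024, status: under-review]
[cite: Kobayashi2003, Thm. 1.2, Thm. 4.1] [cite: BDKim2013, Cor. 3.15 (p. 199)] [cite: Miller2011LMS, §1 and Def. 1.1] -/
theorem wallCornerX6r0_of_printX6_thm13_OPEN (hPub : PublishedInputsX6) (hU : UpperHalfX6)
    (h13 : BurungaleSkinnerTianWan2024_thm13_OPEN) : Summit.BirchSwinnertonDyer.WAllCornerX6r0 :=
  X6RankZero.wallCornerX6r0_of_upper_of_eisensteinHalves hPub.2.2.2.2.2.2.2.2 (hU hPub)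
    (eisensteinHalfFiveLe_of_thm13_OPEN hPub h13) (eisensteinHalfAtThree_of_thm13_OPEN hPub h13)

/-- **The leaf on road P from the inputs ALONE**: `PublishedInputsX6 → thm13_OPEN → WAllCornerX6r0` — ONE PRE binder +
the nine refereed inputs, the upper half by `X6.missingUpperBoundAt_rankZero_of_thm41` (kernel, no Wuthrich).
CONDITIONAL; 0 cells booked. [claim: BurungaleSkinnerTianWan2024, status: under-review]
[cite: Kobayashi2003, Thm. 1.2, Thm. 4.1 (p. 8)] [cite: BDKim2013, Cor. 3.15 (p. 199)] [cite: Miller2011LMS, §1 and Def. 1.1] -/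
theorem wallCornerX6r0_of_publishedInputsX6_thm13_OPEN (hPub : PublishedInputsX6)
    (h13 : BurungaleSkinnerTianWan2024_thm13_OPEN) : Summit.BirchSwinnertonDyer.WAllCornerX6r0 := by
  have ⟨h12, h41, hKim, hper, hper3, _, hmodP, hmod, hGZK⟩ := hPub
  exact wallCornerX6r0_of_printX6_thm13_OPEN hPub
    (fun _ W _ _ p _ hp hX h0 ↦
      X6.missingUpperBoundAt_rankZero_of_thm41 W p h41 h12 hKim hper hper3 hmodP hmod hGZK hp hX h0) h13

/-! ### §3 Road V — Thm. 1.5 (the printed VALUE statement): the minimal binder set {Thm. 1.5 (PRE), GZK (PUB)} -/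

/-- **Crux 2 BY NAME on road V**: `thm15_pPart_OPEN → GZK → EisensteinHalfFiveLe`. Thm. 1.5 on the leaf gives Miller's
`BSD(E,p)` (tree `X6.bsdp_of_thm15_OPEN'`: "(irr)" = `ClassX6.irr`, no torsion term since `p ∤ #E(ℚ)_tors`), whence the
lower bound `MissingLowerBoundAt W p` (ty2 `X6RankZero.missingLowerBoundAt_of_bsdp`) and the item's valuation inequality
at the unique rational value of `#Ш_an` (`padicValRat_le_of_missingLowerBoundAt`). NO Kobayashi / Kim / modularity
input: the minimal print-dependence of the crux. CONDITIONAL; the crux stays OPEN.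
[claim: BurungaleSkinnerTianWan2024, status: under-review] [cite: Serre1972, §1.11 Prop. 12] [cite: Miller2011LMS, §1 and Def. 1.1] -/
theorem eisensteinHalfFiveLe_of_thm15_OPEN (h15 : thm15_pPart_OPEN)
    (hGZK : rank_eq_analyticRank_of_analyticRank_le_one) : EisensteinHalfFiveLe := by
  intro W _ _ p _ _ h5 hX h0 q hq _
  exact padicValRat_le_of_missingLowerBoundAt W p
    (X6RankZero.missingLowerBoundAt_of_bsdp W p hGZK h0
      (X6.bsdp_of_thm15_OPEN' h15 hGZK W p (by omega) hX (by omega))) q hq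

/-- **Residual crux 3 BY NAME on road V**: `thm15_pPart_OPEN → GZK → EisensteinHalfAtThree`. CONDITIONAL; the crux
stays OPEN. [claim: BurungaleSkinnerTianWan2024, status: under-review] [cite: Serre1972, §1.11 Prop. 12]
[cite: Miller2011LMS, §1 and Def. 1.1] -/
theorem eisensteinHalfAtThree_of_thm15_OPEN (h15 : thm15_pPart_OPEN)
    (hGZK : rank_eq_analyticRank_of_analyticRank_le_one) : EisensteinHalfAtThree := by
  intro W _ _ p _ _ h3 hX h0 q hq _
  exact padicValRat_le_of_missingLowerBoundAt W p
    (X6RankZero.missingLowerBoundAt_of_bsdp W p hGZK h0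
      (X6.bsdp_of_thm15_OPEN' h15 hGZK W p (by omega) hX (by omega))) q hq

/-- **Both cruxes at once on road V from `PublishedInputsX6`'s own GZK conjunct**: `PublishedInputsX6 → thm15_pPart_OPEN
→ EisensteinHalfFiveLe ∧ EisensteinHalfAtThree`. CONDITIONAL. [claim: BurungaleSkinnerTianWan2024, status: under-review]
[cite: Miller2011LMS, §1 and Def. 1.1] -/
theorem eisensteinHalves_of_thm15_OPEN (hPub : PublishedInputsX6) (h15 : thm15_pPart_OPEN) :
    EisensteinHalfFiveLe ∧ EisensteinHalfAtThree :=
  ⟨eisensteinHalfFiveLe_of_thm15_OPEN h15 hPub.2.2.2.2.2.2.2.2,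
    eisensteinHalfAtThree_of_thm15_OPEN h15 hPub.2.2.2.2.2.2.2.2⟩

/-- **The leaf on road V in the turnkey shape**: `PublishedInputsX6 → UpperHalfX6 → thm15_pPart_OPEN → WAllCornerX6r0`
(halves from Thm. 1.5, glued by the assembly kernel form). Sanity composition only — strictly weaker than gen 0's
direct `PrintX6.wallCornerX6r0_of_bstw15_OPEN : thm15_pPart_OPEN → GZK → WAllCornerX6r0` (p531830), which needs no
Kobayashi/Kim input; recorded so that all three roads read through the same assembly. CONDITIONAL; 0 cells booked.
[claim: BurungaleSkinnerTianWan2024, status: under-review] [cite: Miller2011LMS, §1 and Def. 1.1] -/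
theorem wallCornerX6r0_of_printX6_thm15_OPEN (hPub : PublishedInputsX6) (hU : UpperHalfX6)
    (h15 : thm15_pPart_OPEN) : Summit.BirchSwinnertonDyer.WAllCornerX6r0 :=
  X6RankZero.wallCornerX6r0_of_upper_of_eisensteinHalves hPub.2.2.2.2.2.2.2.2 (hU hPub)
    (eisensteinHalves_of_thm15_OPEN hPub h15).1 (eisensteinHalves_of_thm15_OPEN hPub h15).2

/-! ### §4 Road K — the cruxes as value-level shadows of the sister route's crux `KobayashiLowerHalfSemistable`
(route `SignedLowerHalves`, stmt-BirchSwinnertonDyer-19000, OPEN): the route header's «mooted-if» clause in kernel form -/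

/-- **Birth-skeleton stub 1 of crux 2 is a RESTRICTION of K3's crux** (PLAN v2 p1 (b)): `KobayashiLowerHalfSemistable →
stub_signedLowerDivisibilityFiveLe` (signature VERBATIM; drop `¬CM`, `r_an = 0`, restrict `p ≠ 2` to `5 ≤ p`). Pure
logic; CONDITIONAL on the sister crux (OPEN), which is thereby the ONE statement both print cells share.
[cite: Kobayashi2003, Conjecture (Main Conjecture) (p. 2)] -/
theorem stub_signedLowerDivisibilityFiveLe_of_kobayashiLowerHalfSemistable
    (h : Summit.BirchSwinnertonDyer.BirchSwinnertonDyer.Theses.SignedLowerHalves.KobayashiLowerHalfSemistable) :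
    ∀ (W : WeierstrassCurve ℚ) [W.IsElliptic] [W.IsGloballyMinimal] (p : ℕ) [Fact p.Prime],
      ¬ W.HasCM → 5 ≤ p → Literature.NumberTheory.EllipticCurves.Rank1Residual.ClassX6 W p →
      W.analyticRank = 0 →
      ∃ ε : ℤˣ, Summit.BirchSwinnertonDyer.Rank1Residual.Supersingular.KobayashiLowerDivisibility W p ε := by
  intro W _ _ p _ _ h5 hX _
  exact h W p (by omega) hX

/-- **The `p = 3` twin** (PLAN v2 p1 (b)): `KobayashiLowerHalfSemistable → stub_signedLowerDivisibilityAtThree`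
(registered on stmt-…-20285, signature VERBATIM). Pure logic; CONDITIONAL on the sister crux.
[cite: Kobayashi2003, Conjecture (Main Conjecture) (p. 2)] -/
theorem stub_signedLowerDivisibilityAtThree_of_kobayashiLowerHalfSemistable
    (h : Summit.BirchSwinnertonDyer.BirchSwinnertonDyer.Theses.SignedLowerHalves.KobayashiLowerHalfSemistable) :
    ∀ (W : WeierstrassCurve ℚ) [W.IsElliptic] [W.IsGloballyMinimal] (p : ℕ) [Fact p.Prime],
      ¬ W.HasCM → p = 3 → Literature.NumberTheory.EllipticCurves.Rank1Residual.ClassX6 W p →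
      W.analyticRank = 0 →
      ∃ ε : ℤˣ, Summit.BirchSwinnertonDyer.Rank1Residual.Supersingular.KobayashiLowerDivisibility W p ε := by
  intro W _ _ p _ _ h3 hX _
  exact h W p (by omega) hX

/-- **Both cruxes BY NAME from K3's crux BY NAME** (PLAN v2 p1 (a)): `KobayashiLowerHalfSemistable → PublishedInputsX6 →
EisensteinHalfFiveLe ∧ EisensteinHalfAtThree` — PrintX6's cruxes are the value-level shadows (r_an = 0, split
`5 ≤ p` / `p = 3`) of route `SignedLowerHalves`' item stmt-BirchSwinnertonDyer-19000, through the ty2 adapters (descent: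
Kobayashi Thm. 1.2, Kim Cor. 3.15, Pollack = tree theorem, modularity, GZK). If K3 closes 19000 flag-free, both cruxes
follow by this theorem (the route header's «mooted-if» clause). CONDITIONAL on the sister crux (OPEN); closes nothing.
[cite: Kobayashi2003, Thm. 1.2 and Conjecture (p. 2)] [cite: BDKim2013, Cor. 3.15 (p. 199)] [cite: Miller2011LMS, Def. 1.1] -/
theorem eisensteinHalves_of_kobayashiLowerHalfSemistable
    (h : Summit.BirchSwinnertonDyer.BirchSwinnertonDyer.Theses.SignedLowerHalves.KobayashiLowerHalfSemistable)
    (hPub : PublishedInputsX6) : EisensteinHalfFiveLe ∧ EisensteinHalfAtThree := by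
  have ⟨h12, _, hKim, _, _, _, hmodP, hmod, hGZK⟩ := hPub
  exact ⟨X6RankZero.eisensteinHalfFiveLe_of_forall_kobayashiLowerDivisibility h12 hKim hmodP hmod hGZK
      fun W _ _ p _ h5 hX h0 ↦
        stub_signedLowerDivisibilityFiveLe_of_kobayashiLowerHalfSemistable h W p (ClassX6.not_hasCM W hX) h5 hX h0,
    X6RankZero.eisensteinHalfAtThree_of_forall_kobayashiLowerDivisibility h12 hKim hmodP hmod hGZK
      fun W _ _ p _ h3 hX h0 ↦
        stub_signedLowerDivisibilityAtThree_of_kobayashiLowerHalfSemistable h W p (ClassX6.not_hasCM W hX) h3 hX h0⟩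

/-- **The leaf from K3's crux in the turnkey shape**: `PublishedInputsX6 → UpperHalfX6 → KobayashiLowerHalfSemistable →
WAllCornerX6r0` — Wuthrich-FREE (contrast ty2's `X6RankZero.wallCornerX6r0_of_forall_kobayashiLowerDivisibility`, the
Wuthrich road, and `…_of_upper_of_forall_kobayashiLowerDivisibility`, the same content with the upper half unfolded).
CONDITIONAL on the sister crux (OPEN); 0 cells booked. [cite: Kobayashi2003, Thm. 1.2, Thm. 4.1 and Conjecture (p. 2)]
[cite: BDKim2013, Cor. 3.15 (p. 199)] [cite: Miller2011LMS, §1 and Def. 1.1] -/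
theorem wallCornerX6r0_of_printX6_kobayashiLowerHalfSemistable (hPub : PublishedInputsX6) (hU : UpperHalfX6)
    (h : Summit.BirchSwinnertonDyer.BirchSwinnertonDyer.Theses.SignedLowerHalves.KobayashiLowerHalfSemistable) :
    Summit.BirchSwinnertonDyer.WAllCornerX6r0 :=
  X6RankZero.wallCornerX6r0_of_upper_of_eisensteinHalves hPub.2.2.2.2.2.2.2.2 (hU hPub)
    (eisensteinHalves_of_kobayashiLowerHalfSemistable h hPub).1
    (eisensteinHalves_of_kobayashiLowerHalfSemistable h hPub).2

end Summit.BirchSwinnertonDyer.BirchSwinnertonDyer.Theorems.PrintX6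

end
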